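import Summits.CriticalPhenomena.PercolationContinuityZ3.Theorems.PercNearOneGluingNoHeavyQuantIndepBlobFar
import HarnessLib

/-!
# QUANT lane R8, FAR for independent blobs (III): the half-mean small-ball inequality in its natural one-type form
# `P(X < EX/2) ≤ 1 − min_k p_k`, and with the minimum over the RELEVANT gates only

builds on p205010 (kernel theorem, internal audit signed; external expert review pending)

Support file (`--supports stmt-CriticalPhenomena-4575`), QUANT lane lead (gen 5); memo
`run/shared/lean/prim/quant/prim-quant-lead-g5/LEAD-NOTES-G5.md` N12–N13.

Part 1 (one-type form).  `…QuantIndepBlobFar.lean` states the inequality conditioned on a distinguished least reliable gate `(p₀, a₀)`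
next to a family indexed by a type `ι`.  Here all gates are indexed by ONE finite type `κ`, `y : κ` is a least reliable gate (`p y ≤ p k`
for all `k`), `X(s) = ∑_{k∈s} a k` is the weight of the set `s` of open gates, `m = ∑ a k p k` its mean, and the statement reads
`∑_{s : X(s) < m/2} ∏_k (p k if k ∈ s else 1 − p k) ≤ 1 − p y` (`halfMean_smallBall_min`), with the layer form
`2j < m ⟹ P(X ≤ j) ≤ 1 − p y` (`far_indepBlob_min`).  Proof: split configurations `s ⊆ κ` according to `y ∈ s`, identify the rest with
configurations of the subtype `{k // k ≠ y}`, and apply `IndepBlob.halfMean_smallBall`.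
Part 2 (relevant gates only).  Gates `k` with weight `a k = 0` do not enter `X`, so the bound should only see the gates with `a k ≠ 0`:
if `a y ≠ 0` and `p y ≤ p k` for every `k` with `a k ≠ 0` then `P(X < EX/2) ≤ 1 − p y` (`halfMean_smallBall_support`, `far_indepBlob_support`).
Proof: glue the irrelevant gates (`p k := 1` when `a k = 0`); the law of `X` is unchanged because a sum of product weights against a function
that ignores a coordinate does not depend on that coordinate's gate (`sum_weight_mul_eq_sum_erase`, `sum_weight_mul_update`, `sum_weight_mul_glue`).
This is the form needed by the percolation-vocabulary instance `Quant.farRelayRow_star` (coordinates = all pairs `Sym2 (Fin n)`, only star edges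
carry relays).  No new definitions; standard axioms.
-/
namespace Summit.CriticalPhenomena.PercolationContinuityZ3.Theorems

namespace Quant

namespace IndepBlob

open Finset

variable {κ : Type*} [Fintype κ] [DecidableEq κ]

/-- Reindexing: subsets of `univ.erase y` are the images of the finsets of the subtype `{k // k ≠ y}`. [folklore] -/
theorem sum_powerset_erase_eq_sum_subtype (y : κ) (G : Finset κ → ℝ) :
    ∑ t ∈ (Finset.univ.erase y).powerset, G t =
      ∑ W : Finset {k : κ // k ≠ y}, G (W.map (Function.Embedding.subtype _)) := by
  symm
  refine Finset.sum_nbij' (fun W => W.map (Function.Embedding.subtype _)) (fun t => t.subtype (· ≠ y))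
    (fun W _ => ?_) (fun t _ => Finset.mem_univ _) (fun W _ => ?_) (fun t ht => ?_) (fun W _ => rfl)
  · rw [Finset.mem_powerset]
    intro x hx
    rw [Finset.mem_map] at hx
    obtain ⟨i, -, rfl⟩ := hx
    exact Finset.mem_erase.2 ⟨i.2, Finset.mem_univ _⟩
  · ext i
    rw [Finset.mem_subtype, Finset.mem_map]
    constructor
    · rintro ⟨i', hi', he⟩
      have : i' = i := Subtype.ext he
      rw [← this]; exact hi'
    · intro h
      exact ⟨i, h, rfl⟩
  · rw [Finset.mem_powerset] at ht
    exact Finset.subtype_map_of_mem fun x hx => (Finset.mem_erase.1 (ht hx)).1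

/-- The product weight of a configuration avoiding `y`, read on the subtype. [folklore] -/
theorem prod_ite_mem_map_subtype (p : κ → ℝ) (y : κ) (W : Finset {k : κ // k ≠ y}) :
    (∏ k, if k ∈ W.map (Function.Embedding.subtype _) then p k else 1 - p k) =
      (1 - p y) * ∏ i : {k : κ // k ≠ y}, (if i ∈ W then p i else 1 - p i) := by
  have hy : y ∉ W.map (Function.Embedding.subtype _) := by
    intro h
    rw [Finset.mem_map] at h
    obtain ⟨i, -, hi⟩ := h
    exact i.2 hi
  rw [← Finset.mul_prod_erase Finset.univ _ (Finset.mem_univ y), if_neg hy]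
  congr 1
  rw [Finset.prod_subtype (Finset.univ.erase y) (p := fun k => k ≠ y) (fun k => by simp)]
  refine Finset.prod_congr rfl fun i _ => ?_
  have : ((i : κ) ∈ W.map (Function.Embedding.subtype _)) ↔ i ∈ W := by
    constructor
    · intro h
      rw [Finset.mem_map] at h
      obtain ⟨i', hi', he⟩ := h
      have : i' = i := Subtype.ext he
      rw [← this]; exact hi'
    · intro h
      exact Finset.mem_map.2 ⟨i, h, rfl⟩
  simp only [this]

/-- The product weight of a configuration containing `y`, read on the subtype. [folklore] -/
theorem prod_ite_mem_insert_map_subtype (p : κ → ℝ) (y : κ) (W : Finset {k : κ // k ≠ y}) :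
    (∏ k, if k ∈ insert y (W.map (Function.Embedding.subtype _)) then p k else 1 - p k) =
      p y * ∏ i : {k : κ // k ≠ y}, (if i ∈ W then p i else 1 - p i) := by
  rw [← Finset.mul_prod_erase Finset.univ _ (Finset.mem_univ y), if_pos (Finset.mem_insert_self _ _)]
  congr 1
  rw [Finset.prod_subtype (Finset.univ.erase y) (p := fun k => k ≠ y) (fun k => by simp)]
  refine Finset.prod_congr rfl fun i _ => ?_
  have : ((i : κ) ∈ insert y (W.map (Function.Embedding.subtype _))) ↔ i ∈ W := by
    rw [Finset.mem_insert]
    constructor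
    · rintro (h | h)
      · exact absurd h i.2
      · rw [Finset.mem_map] at h
        obtain ⟨i', hi', he⟩ := h
        have : i' = i := Subtype.ext he
        rw [← this]; exact hi'
    · intro h
      exact Or.inr (Finset.mem_map.2 ⟨i, h, rfl⟩)
  simp only [this]

/-- **Half-mean small-ball inequality, one-type form.**  For gates `0 ≤ p k ≤ 1` and weights `a k ≥ 0` indexed by a finite type `κ`
and a least reliable gate `y` (`p y ≤ p k` for all `k`): the product-Bernoulli probability that the weight of the open set is
below half its mean is at most `1 − p y`:
`∑_{s : ∑_{k∈s} a k < (∑_k a k p k)/2} ∏_k (if k ∈ s then p k else 1 − p k) ≤ 1 − p y`.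
Equivalently `P(X ≥ EX/2) ≥ min_k p_k` for `X = ∑ a_k ε_k` with independent Bernoulli gates. [this work] -/
theorem halfMean_smallBall_min (p a : κ → ℝ) (hp0 : ∀ k, 0 ≤ p k) (hp1 : ∀ k, p k ≤ 1) (ha : ∀ k, 0 ≤ a k)
    (y : κ) (hy : ∀ k, p y ≤ p k) :
    ∑ s ∈ (Finset.univ : Finset (Finset κ)).filter (fun s => ∑ k ∈ s, a k < (∑ k, a k * p k) / 2),
      (∏ k, if k ∈ s then p k else 1 - p k) ≤ 1 - p y := by
  set ι := {k : κ // k ≠ y} with hι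
  set emb : ι ↪ κ := Function.Embedding.subtype _ with hemb
  set m : ℝ := ∑ k, a k * p k with hm
  -- the mean, split at `y`
  have hm' : m = a y * p y + ∑ i : ι, a i * p i := by
    rw [hm, ← Finset.add_sum_erase Finset.univ _ (Finset.mem_univ y),
      Finset.sum_subtype (Finset.univ.erase y) (p := fun k => k ≠ y) (fun k => by simp)]
  -- the main theorem on the subtype, with the distinguished gate `(p y, a y)`
  have key := halfMean_smallBall (ι := ι) (fun i => p i) (fun i => a i) (p y) (a y) (hp0 y) (hp1 y)
    (fun i => hy i) (fun i => hp1 i) (fun i => ha i) (ha y)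
  rw [← hm'] at key
  -- split the configurations `s ⊆ κ` according to `y ∈ s`
  set G : Finset κ → ℝ := fun s => if ∑ k ∈ s, a k < m / 2 then (∏ k, if k ∈ s then p k else 1 - p k) else 0
    with hG
  have hLHS : ∑ s ∈ (Finset.univ : Finset (Finset κ)).filter (fun s => ∑ k ∈ s, a k < m / 2),
      (∏ k, if k ∈ s then p k else 1 - p k) = ∑ s : Finset κ, G s := by
    rw [hG, Finset.sum_filter]
  have hsplit : ∑ s : Finset κ, G s =
      ∑ W : Finset ι, G (W.map emb) + ∑ W : Finset ι, G (insert y (W.map emb)) := by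
    rw [← Finset.powerset_univ, ← Finset.insert_erase (Finset.mem_univ y),
      Finset.sum_powerset_insert (Finset.notMem_erase y _), sum_powerset_erase_eq_sum_subtype,
      sum_powerset_erase_eq_sum_subtype]
  -- the two pieces, read on the subtype
  have hnot : ∀ W : Finset ι, y ∉ W.map emb := by
    intro W h
    rw [Finset.mem_map] at h
    obtain ⟨i, -, hi⟩ := h
    exact i.2 hi
  have h0 : ∑ W : Finset ι, G (W.map emb) =
      (1 - p y) * ∑ W ∈ (Finset.univ : Finset (Finset ι)).filter (fun W : Finset ι => ∑ i ∈ W, a i < m / 2),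
        (∏ i : ι, if i ∈ W then p i else 1 - p i) := by
    rw [Finset.sum_filter, Finset.mul_sum]
    refine Finset.sum_congr rfl fun W _ => ?_
    have hX : ∑ k ∈ W.map emb, a k = ∑ i ∈ W, a i := Finset.sum_map _ _ _
    simp only [hG, hX]
    split_ifs
    · rw [hemb, prod_ite_mem_map_subtype]
    · rw [mul_zero]
  have h1 : ∑ W : Finset ι, G (insert y (W.map emb)) =
      p y * ∑ W ∈ (Finset.univ : Finset (Finset ι)).filter (fun W : Finset ι => ∑ i ∈ W, a i + a y < m / 2),
        (∏ i : ι, if i ∈ W then p i else 1 - p i) := by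
    rw [Finset.sum_filter, Finset.mul_sum]
    refine Finset.sum_congr rfl fun W _ => ?_
    have hX : ∑ k ∈ insert y (W.map emb), a k = ∑ i ∈ W, a i + a y := by
      rw [Finset.sum_insert (hnot W), Finset.sum_map, add_comm]
      rfl
    simp only [hG, hX]
    split_ifs
    · rw [hemb, prod_ite_mem_insert_map_subtype]
    · rw [mul_zero]
  rw [hLHS, hsplit, h0, h1]
  linarith [key]

/-- **FAR for independent blobs, one-type layer form.**  With the data of `halfMean_smallBall_min` and `2j < m = ∑ a k p k`:
`P(∑_{k ∈ open} a k ≤ j) ≤ 1 − p y = max_k P(gate k closed)` — the far-relay row of `Quant.FarRelayRow` for an observer joined by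
independent gates `p k` to disjoint glued blobs of `a k` relays. [this work] -/
theorem far_indepBlob_min (p a : κ → ℝ) (hp0 : ∀ k, 0 ≤ p k) (hp1 : ∀ k, p k ≤ 1) (ha : ∀ k, 0 ≤ a k)
    (y : κ) (hy : ∀ k, p y ≤ p k) (j : ℝ) (hj : 2 * j < ∑ k, a k * p k) :
    ∑ s ∈ (Finset.univ : Finset (Finset κ)).filter (fun s => ∑ k ∈ s, a k ≤ j),
      (∏ k, if k ∈ s then p k else 1 - p k) ≤ 1 - p y := by
  refine le_trans ?_ (halfMean_smallBall_min p a hp0 hp1 ha y hy)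
  refine Finset.sum_le_sum_of_subset_of_nonneg (fun s hs => ?_) fun s _ _ => bernoulliWeight_nonneg hp0 hp1 s
  rw [Finset.mem_filter] at hs ⊢
  exact ⟨hs.1, by linarith [hs.2]⟩

end IndepBlob

end Quant

end Summit.CriticalPhenomena.PercolationContinuityZ3.Theorems
namespace Summit.CriticalPhenomena.PercolationContinuityZ3.Theorems

namespace Quant

namespace IndepBlob

open Finset

variable {κ : Type*} [Fintype κ] [DecidableEq κ]

/-- Integrating out one coordinate: if `F` ignores the coordinate `k₀` then
`∑_s w_q(s) F(s) = ∑_{t ⊆ univ ∖ k₀} (∏_{k ≠ k₀} (q k if k ∈ t else 1 − q k)) F(t)` — the gate `q k₀` disappears. [folklore] -/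
theorem sum_weight_mul_eq_sum_erase (q : κ → ℝ) (k₀ : κ) (F : Finset κ → ℝ)
    (hF : ∀ s : Finset κ, k₀ ∉ s → F (insert k₀ s) = F s) :
    ∑ s : Finset κ, (∏ k, if k ∈ s then q k else 1 - q k) * F s =
      ∑ t ∈ (Finset.univ.erase k₀).powerset, (∏ k ∈ Finset.univ.erase k₀, if k ∈ t then q k else 1 - q k) * F t := by
  rw [← Finset.powerset_univ, ← Finset.insert_erase (Finset.mem_univ k₀),
    Finset.sum_powerset_insert (Finset.notMem_erase k₀ _), Finset.insert_erase (Finset.mem_univ k₀),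
    ← Finset.sum_add_distrib]
  refine Finset.sum_congr rfl fun t ht => ?_
  have hk₀ : k₀ ∉ t := fun h => Finset.notMem_erase k₀ Finset.univ (Finset.mem_powerset.1 ht h)
  have h0 : (∏ k, if k ∈ t then q k else 1 - q k) =
      (1 - q k₀) * ∏ k ∈ Finset.univ.erase k₀, (if k ∈ t then q k else 1 - q k) := by
    rw [← Finset.mul_prod_erase Finset.univ _ (Finset.mem_univ k₀), if_neg hk₀]
  have h1 : (∏ k, if k ∈ insert k₀ t then q k else 1 - q k) =
      q k₀ * ∏ k ∈ Finset.univ.erase k₀, (if k ∈ t then q k else 1 - q k) := by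
    rw [← Finset.mul_prod_erase Finset.univ _ (Finset.mem_univ k₀), if_pos (Finset.mem_insert_self _ _)]
    congr 1
    refine Finset.prod_congr rfl fun k hk => ?_
    have hne : k ≠ k₀ := (Finset.mem_erase.1 hk).1
    have : (k ∈ insert k₀ t) ↔ k ∈ t := by
      rw [Finset.mem_insert]
      exact ⟨fun h => h.resolve_left hne, Or.inr⟩
    simp only [this]
  rw [hF t hk₀, h0, h1]
  ring

/-- Changing the gate of a coordinate that `F` ignores does not change `∑_s w(s) F(s)`. [folklore] -/
theorem sum_weight_mul_update (p : κ → ℝ) (k₀ : κ) (c : ℝ) (F : Finset κ → ℝ)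
    (hF : ∀ s : Finset κ, k₀ ∉ s → F (insert k₀ s) = F s) :
    ∑ s : Finset κ, (∏ k, if k ∈ s then Function.update p k₀ c k else 1 - Function.update p k₀ c k) * F s =
      ∑ s : Finset κ, (∏ k, if k ∈ s then p k else 1 - p k) * F s := by
  rw [sum_weight_mul_eq_sum_erase _ k₀ F hF, sum_weight_mul_eq_sum_erase _ k₀ F hF]
  refine Finset.sum_congr rfl fun t _ => ?_
  congr 1
  refine Finset.prod_congr rfl fun k hk => ?_
  have hne : k ≠ k₀ := (Finset.mem_erase.1 hk).1
  rw [Function.update_of_ne hne]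

/-- Gluing every irrelevant gate: with `glue p a k = 1` if `a k = 0` and `p k` otherwise (written out), the sum of the product weights
against any `F` that ignores the coordinates with `a k = 0` is unchanged. [this work] -/
theorem sum_weight_mul_glue (p a : κ → ℝ) (F : Finset κ → ℝ)
    (hF : ∀ (k₀ : κ) (s : Finset κ), a k₀ = 0 → k₀ ∉ s → F (insert k₀ s) = F s) :
    ∑ s : Finset κ, (∏ k, if k ∈ s then (if a k = 0 then 1 else p k) else 1 - (if a k = 0 then 1 else p k)) * F s =
      ∑ s : Finset κ, (∏ k, if k ∈ s then p k else 1 - p k) * F s := by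
  -- glue the coordinates of a finset `U` of irrelevant coordinates, by induction on `U`
  suffices h : ∀ U : Finset κ, (∀ k ∈ U, a k = 0) →
      ∑ s : Finset κ, (∏ k, if k ∈ s then (if k ∈ U then 1 else p k) else 1 - (if k ∈ U then 1 else p k)) * F s =
        ∑ s : Finset κ, (∏ k, if k ∈ s then p k else 1 - p k) * F s by
    have hU := h (Finset.univ.filter fun k => a k = 0) (fun k hk => (Finset.mem_filter.1 hk).2)
    rw [← hU]
    refine Finset.sum_congr rfl fun s _ => ?_
    congr 1
    refine Finset.prod_congr rfl fun k _ => ?_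
    have : (k ∈ Finset.univ.filter fun k => a k = 0) ↔ a k = 0 := by simp
    simp only [this]
  intro U
  induction U using Finset.induction_on with
  | empty =>
    intro _
    refine Finset.sum_congr rfl fun s _ => ?_
    simp
  | @insert k₀ U hk₀U ih =>
    intro hU
    have hU' : ∀ k ∈ U, a k = 0 := fun k hk => hU k (Finset.mem_insert_of_mem hk)
    have hk₀ : a k₀ = 0 := hU k₀ (Finset.mem_insert_self _ _)
    rw [← ih hU']
    -- the gates with `U ∪ {k₀}` glued are the `k₀`-update of the gates with `U` glued
    have hupd : (fun k => if k ∈ insert k₀ U then (1 : ℝ) else p k) =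
        Function.update (fun k => if k ∈ U then (1 : ℝ) else p k) k₀ 1 := by
      funext k
      by_cases hk : k = k₀
      · subst hk
        simp
      · rw [Function.update_of_ne hk]
        simp [Finset.mem_insert, hk]
    have := sum_weight_mul_update (fun k => if k ∈ U then (1 : ℝ) else p k) k₀ 1 F (fun s hs => hF k₀ s hk₀ hs)
    rw [← hupd] at this
    exact this

/-- **Half-mean small-ball inequality, relevant gates only.**  Gates `0 ≤ p k ≤ 1`, weights `a k ≥ 0` on a finite type `κ`, and a gate
`y` of nonzero weight that is least reliable among the gates of nonzero weight (`a y ≠ 0`, and `p y ≤ p k` whenever `a k ≠ 0`). Then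
`∑_{s : ∑_{k∈s} a k < (∑_k a k p k)/2} ∏_k (if k ∈ s then p k else 1 − p k) ≤ 1 − p y`, i.e. `P(X < EX/2) ≤ max_{k : a k ≠ 0} P(gate k closed)`.
Proof: glue the irrelevant gates (`sum_weight_mul_glue`) and apply `halfMean_smallBall_min`. [this work] -/
theorem halfMean_smallBall_support (p a : κ → ℝ) (hp0 : ∀ k, 0 ≤ p k) (hp1 : ∀ k, p k ≤ 1) (ha : ∀ k, 0 ≤ a k)
    (y : κ) (hay : a y ≠ 0) (hy : ∀ k, a k ≠ 0 → p y ≤ p k) :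
    ∑ s ∈ (Finset.univ : Finset (Finset κ)).filter (fun s => ∑ k ∈ s, a k < (∑ k, a k * p k) / 2),
      (∏ k, if k ∈ s then p k else 1 - p k) ≤ 1 - p y := by
  set p' : κ → ℝ := fun k => if a k = 0 then 1 else p k with hp'
  have hp'0 : ∀ k, 0 ≤ p' k := fun k => by
    simp only [hp']
    split_ifs
    · norm_num
    · exact hp0 k
  have hp'1 : ∀ k, p' k ≤ 1 := fun k => by
    simp only [hp']
    split_ifs
    · norm_num
    · exact hp1 k
  have hy' : ∀ k, p' y ≤ p' k := fun k => by
    simp only [hp', if_neg hay]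
    split_ifs with hk
    · exact hp1 y
    · exact hy k hk
  have hm : ∑ k, a k * p' k = ∑ k, a k * p k := by
    refine Finset.sum_congr rfl fun k _ => ?_
    simp only [hp']
    split_ifs with hk
    · rw [hk, zero_mul, zero_mul]
    · rfl
  have key := halfMean_smallBall_min p' a hp'0 hp'1 ha y hy'
  rw [hm] at key
  have hpy : p' y = p y := by simp only [hp', if_neg hay]
  rw [hpy] at key
  -- the event ignores the irrelevant coordinates, so its probability is the same for `p` and `p'`
  set F : Finset κ → ℝ := fun s => if ∑ k ∈ s, a k < (∑ k, a k * p k) / 2 then 1 else 0 with hFdef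
  have hF : ∀ (k₀ : κ) (s : Finset κ), a k₀ = 0 → k₀ ∉ s → F (insert k₀ s) = F s := by
    intro k₀ s hk₀ hs
    simp only [hFdef, Finset.sum_insert hs, hk₀, zero_add]
  have hglue := sum_weight_mul_glue p a F hF
  have hL : ∀ q : κ → ℝ, ∑ s ∈ (Finset.univ : Finset (Finset κ)).filter (fun s => ∑ k ∈ s, a k < (∑ k, a k * p k) / 2),
      (∏ k, if k ∈ s then q k else 1 - q k) = ∑ s : Finset κ, (∏ k, if k ∈ s then q k else 1 - q k) * F s := by
    intro q
    rw [Finset.sum_filter]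
    refine Finset.sum_congr rfl fun s _ => ?_
    simp only [hFdef]
    split_ifs <;> simp
  rw [hL p, ← hglue, ← hL p']
  exact key

/-- **FAR for independent blobs, relevant gates only (layer form).**  With the data of `halfMean_smallBall_support` and
`2j < ∑_k a k p k`: `P(∑_{k open} a k ≤ j) ≤ 1 − p y`. [this work] -/
theorem far_indepBlob_support (p a : κ → ℝ) (hp0 : ∀ k, 0 ≤ p k) (hp1 : ∀ k, p k ≤ 1) (ha : ∀ k, 0 ≤ a k)
    (y : κ) (hay : a y ≠ 0) (hy : ∀ k, a k ≠ 0 → p y ≤ p k) (j : ℝ) (hj : 2 * j < ∑ k, a k * p k) :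
    ∑ s ∈ (Finset.univ : Finset (Finset κ)).filter (fun s => ∑ k ∈ s, a k ≤ j),
      (∏ k, if k ∈ s then p k else 1 - p k) ≤ 1 - p y := by
  refine le_trans ?_ (halfMean_smallBall_support p a hp0 hp1 ha y hay hy)
  refine Finset.sum_le_sum_of_subset_of_nonneg (fun s hs => ?_) fun s _ _ => bernoulliWeight_nonneg hp0 hp1 s
  rw [Finset.mem_filter] at hs ⊢
  exact ⟨hs.1, by linarith [hs.2]⟩

end IndepBlob

end Quant

end Summit.CriticalPhenomena.PercolationContinuityZ3.Theorems
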